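import Mathlib
import HarnessLib
import Summits.ValiantsHypothesis.ValiantsHypothesis.Theorems.ValuativeGCTValuativeFlipPaddingTransferPoints
import Summits.ValiantsHypothesis.ValiantsHypothesis.Theorems.ValuativeGCTValuativeFlipNoSmallBodyEquations
import Literature.Computability.AlgebraicComplexity.PlethysmLifting
import Literature.Computability.AlgebraicComplexity.OrbitClosureWeights

/-!
# `ValuativeGCT.TailFlip` (stmt-ValiantsHypothesis-15687), line `boundary-ray-collapse`:
# the registered stub `stub_boundaryTwistScalar` (L1, KL-boundary twist invisibility)

Letters: inner (permanent) size `n`, padded base level `m₀` (`n < m₀`), padding `j`, degree `δ`,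
top variable `X_top = X (topMatIdx m₀)` (the LAST letter, carrying `-λ₁` in the dual weight
`λ* = partitionWeightLex m₀ λ`).  A Kadish–Landsberg BOUNDARY shape for `(n, m₀)` is `λ ⊢ m₀·δ` with
first row EXACTLY `λ₁ = δ(m₀ - n)`.

* `bts_aeval_twist_eq_pow_mul` — the abstract lever: for a form `F` of degree `δ` in letters `d`
  graded by `t d ∈ ℕ`, if every monomial `∏ X_d^{s d}` of `F` has graded count
  `∑ s d · t d = δ · e₀` and the point `c` vanishes on all letters of grade `< e₀`, then twisting the
  point by a grade-dependent factor `w (t d)` multiplies `F(c)` by the scalar `(w e₀)^δ`: a monomial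
  of `F` either meets a letter of grade `< e₀` (killed on both sides) or has all its letters of grade
  exactly `e₀` (the count forces it).
* `stub_boundaryTwistScalar` — verbatim the registered stub of the skeleton
  `Cruxes/TailFlip/Lines/boundary_ray_collapse.lean`: for `F` a highest-weight vector of weight `λ*`
  (`λ` a boundary shape) and a column-normalised `A` (`A · X₀₀ = X_top`), the `Δ_j`-twisted
  evaluation of `F` at `A · X₀₀^{m₀-n} per_n` is `((m₀-n+j).descFactorial j)^δ` times the untwisted
  one.  Proof: `A · X₀₀^{m₀-n} per_n = X_top^{m₀-n} · q` (`paddedPerFormLex_eq`, `linSubst_X`), so its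
  coefficients vanish below the top layer `e(top) ≥ m₀ - n` (`coeff_monomial_mul'`); `F` is a form of
  degree `δ` (`isHomogeneous_of_mem_highestWeightSpace`) whose monomials have torus weight `λ*`
  (`monWeight_eq_of_mem_weightSpace`), i.e. top count `∑ s d · d(top) = λ₁ = δ(m₀ - n)`
  (`monWeight_apply`, `partitionWeightLex_apply_top`); the abstract lever concludes.

Sources: Kadish–Landsberg arXiv:1204.4693 §2; Bürgisser–Ikenmeyer–Panova 2019 Lemma 5.2–5.3;
the line card `Cruxes/TailFlip/Lines/boundary-ray-collapse.md` (§Lever, L1).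
-/

set_option linter.dupNamespace false

namespace Summit.ValiantsHypothesis.ValiantsHypothesis.Theorems.TailFlip

open MvPolynomial
open scoped BigOperators Matrix
open Literature.NumberTheory.DiophantineGeometry
open Literature.Computability.AlgebraicComplexity
open Literature.Computability.Complexity
open Summit.ValiantsHypothesis.ValiantsHypothesis.Theorems.ValuativeFlip

noncomputable section

/-! ## The abstract lever: a graded twist is a scalar on forms of constant graded count -/

/-- **A graded twist acts as a scalar on forms whose monomials have constant graded count.**
Let `F` be a form of degree `δ` in letters `d : ι` graded by `t d ∈ ℕ`, such that every monomial
`∏_d X_d^{s d}` of `F` has graded count `∑_d s d · t d = δ · e₀`, and let `c : ι → ℂ` be a point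
vanishing on every letter of grade `< e₀`.  Then for every `w : ℕ → ℂ`,
`F((w (t d) · c d)_d) = (w e₀)^δ · F(c)`: a monomial of `F` containing a letter of grade `< e₀` is
killed at both points, and otherwise all its letters have grade `≥ e₀`, hence exactly `e₀` by the
count, so its twist factor is `∏ (w e₀)^{s d} = (w e₀)^δ`. [new] -/
theorem bts_aeval_twist_eq_pow_mul {ι : Type*} {F : MvPolynomial ι ℂ} {δ e₀ : ℕ}
    (hF : F.IsHomogeneous δ) (t : ι → ℕ) (w : ℕ → ℂ) (c : ι → ℂ)
    (hwt : ∀ s ∈ F.support, ∑ d ∈ s.support, s d * t d = δ * e₀)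
    (hc : ∀ d, t d < e₀ → c d = 0) :
    aeval (fun d => w (t d) * c d) F = w e₀ ^ δ * aeval c F := by
  simp only [MvPolynomial.aeval_eq_eval]
  rw [MvPolynomial.eval_eq, MvPolynomial.eval_eq, Finset.mul_sum]
  refine Finset.sum_congr rfl fun s hs => ?_
  -- the monomial `s` has degree `δ`
  have hdeg : ∑ d ∈ s.support, s d = δ := by
    have h : s.degree = δ := by
      rw [Finsupp.degree_eq_weight_one]
      exact hF (mem_support_iff.mp hs)
    rwa [Finsupp.degree_apply] at h
  by_cases hall : ∀ d ∈ s.support, t d = e₀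
  · -- all letters of grade `e₀`: the twist factor is `(w e₀)^δ`
    rw [mul_left_comm]
    congr 1
    rw [← hdeg, ← Finset.prod_pow_eq_pow_sum, ← Finset.prod_mul_distrib]
    exact Finset.prod_congr rfl fun d hd => by rw [hall d hd, mul_pow]
  · -- otherwise some letter has grade `< e₀` (the count forbids a strict excess everywhere)
    push Not at hall
    obtain ⟨d₀, hd₀, hne⟩ := hall
    have hlt : ∃ d₁ ∈ s.support, t d₁ < e₀ := by
      by_contra hcon
      push Not at hcon
      have h1 : δ * e₀ < ∑ d ∈ s.support, s d * t d := by
        calc δ * e₀ = ∑ d ∈ s.support, s d * e₀ := by rw [← hdeg, Finset.sum_mul]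
          _ < ∑ d ∈ s.support, s d * t d :=
            Finset.sum_lt_sum (fun d hd => Nat.mul_le_mul_left _ (hcon d hd))
              ⟨d₀, hd₀, Nat.mul_lt_mul_of_pos_left (lt_of_le_of_ne (hcon d₀ hd₀) hne.symm)
                (Nat.pos_of_ne_zero (Finsupp.mem_support_iff.mp hd₀))⟩
      rw [hwt s hs] at h1
      exact lt_irrefl _ h1
    obtain ⟨d₁, hd₁, hlt₁⟩ := hlt
    have hs1 : s d₁ ≠ 0 := Finsupp.mem_support_iff.mp hd₁
    rw [Finset.prod_eq_zero hd₁ (by rw [hc d₁ hlt₁, mul_zero, zero_pow hs1]),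
      Finset.prod_eq_zero hd₁ (by rw [hc d₁ hlt₁, zero_pow hs1]), mul_zero, mul_zero]

/-! ## The stub -/

/-- **stub_boundaryTwistScalar** (L1 — KL-boundary twist invisibility; registered stub of line
`boundary-ray-collapse`, verbatim).  For `n < m₀`, `λ ⊢ m₀·δ` with at most `m₀²` parts and first row
EXACTLY `δ(m₀ - n)`, every highest-weight vector `F` of weight `λ*` on `ℂ[Sym^{m₀} ℂ^{m₀²}]`, every
padding `j` and every column-normalised matrix `A` (`A · X₀₀ = X_top`): the `Δ_j`-twisted evaluation
of `F` at `A · X₀₀^{m₀-n} per_n` is `((m₀-n+j).descFactorial j)^δ` times the untwisted one.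
Proof: `F` is a form of degree `δ` in the coefficient letters (`isHomogeneous_of_mem_highestWeightSpace`,
`size_partitionWeightLex'`) and torus-isobaric: on each of its monomials `∏_i X_{e_i}` one has
`Σ_i e_i(top) = λ₁ = δ(m₀-n)` (`monWeight_eq_of_mem_weightSpace`, `monWeight_apply`,
`partitionWeightLex_apply_top`: the last letter `topMatIdx m₀` carries `-λ₁`); a column-normalised
point is `X_top^{m₀-n} · q` (`paddedPerFormLex_eq`, `linSubst_X`), so `coeff_e = 0` unless
`e(top) ≥ m₀ - n` (`coeff_monomial_mul'`); the abstract lever `bts_aeval_twist_eq_pow_mul` concludes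
(compare the isobaric version `aeval_twist_eq_pow_mul_of_isobaric`).
[Kadish–Landsberg arXiv:1204.4693 §2; BIP arXiv:1604.06431 Lemma 5.3; card §Lever, L1] -/
theorem stub_boundaryTwistScalar :
    ∀ (n m₀ j δ : ℕ) [NeZero m₀], n < m₀ → ∀ (lam : Nat.Partition (m₀ * δ)), lam.parts.card ≤ m₀ * m₀ →
      lam.parts.sup = δ * (m₀ - n) →
      ∀ F ∈ highestWeightSpace (coordRep (MatIdx m₀) ℂ m₀) (partitionWeightLex m₀ lam),
      ∀ A : Matrix (MatIdx m₀) (MatIdx m₀) ℂ,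
        (∀ s, A s (toLex ((0 : Fin m₀), (0 : Fin m₀))) = if s = topMatIdx m₀ then 1 else 0) →
        aeval (fun e : DegIdx (MatIdx m₀) m₀ =>
            (((e.1 (topMatIdx m₀) + j).descFactorial j : ℕ) : ℂ) *
              coeff e.1 (linSubst (MatIdx m₀) ℂ A (paddedPerFormLex ℂ n m₀))) F =
          ((((m₀ - n + j).descFactorial j : ℕ) : ℂ) ^ δ) *
            aeval (fun e : DegIdx (MatIdx m₀) m₀ =>
              coeff e.1 (linSubst (MatIdx m₀) ℂ A (paddedPerFormLex ℂ n m₀))) F := by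
  intro n m₀ j δ _ _hnm lam hlam hsup F hF A hA
  classical
  -- `F` is a form of degree `δ` (the weight `λ*` pins the degree)
  have hhom : F.IsHomogeneous δ :=
    isHomogeneous_of_mem_highestWeightSpace (NeZero.ne m₀) hF (size_partitionWeightLex' lam hlam)
  -- the column-normalised point is `X_top^{m₀-n} · q`
  have hA_pad : linSubst (MatIdx m₀) ℂ A (X (toLex ((0 : Fin m₀), (0 : Fin m₀)))) = X (topMatIdx m₀) := by
    rw [linSubst_X]
    simp_rw [hA]
    simp only [ite_smul, one_smul, zero_smul]
    rw [Finset.sum_ite_eq' Finset.univ (topMatIdx m₀), if_pos (Finset.mem_univ _)]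
  obtain ⟨q, hq⟩ : ∃ q : MvPolynomial (MatIdx m₀) ℂ,
      linSubst (MatIdx m₀) ℂ A (paddedPerFormLex ℂ n m₀) = X (topMatIdx m₀) ^ (m₀ - n) * q := by
    refine ⟨linSubst (MatIdx m₀) ℂ A (rename (fun ij : BlockIdx n m₀ × BlockIdx n m₀ =>
      (toLex ((ij.1 : Fin m₀), (ij.2 : Fin m₀)) : MatIdx m₀)) (perPoly (BlockIdx n m₀) ℂ)), ?_⟩
    rw [paddedPerFormLex_eq, map_mul, map_pow, hA_pad]
  -- so its coefficients vanish below the top layer `e(top) ≥ m₀ - n`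
  have hvan : ∀ e : DegIdx (MatIdx m₀) m₀, e.1 (topMatIdx m₀) < m₀ - n →
      coeff e.1 (linSubst (MatIdx m₀) ℂ A (paddedPerFormLex ℂ n m₀)) = 0 := by
    intro e he
    rw [hq, X_pow_eq_monomial, coeff_monomial_mul', if_neg]
    rw [Finsupp.single_le_iff]
    omega
  -- the torus weight at the top letter: `∑ s d · d(top) = λ₁ = δ(m₀ - n)` on every monomial of `F`
  have hmm : 0 < m₀ * m₀ :=
    Nat.mul_pos (Nat.pos_of_ne_zero (NeZero.ne m₀)) (Nat.pos_of_ne_zero (NeZero.ne m₀))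
  have htop : partitionWeightLex m₀ lam (topMatIdx m₀) = -((lam.parts.sup : ℕ) : ℤ) :=
    partitionWeightLex_apply_top hmm lam
  have hwt : ∀ s ∈ F.support, ∑ d ∈ s.support, s d * d.1 (topMatIdx m₀) = δ * (m₀ - n) := by
    intro s hs
    have hw := monWeight_eq_of_mem_weightSpace (highestWeightSpace_le_weightSpace _ _ hF) hs
    have h := congrFun hw (topMatIdx m₀)
    rw [monWeight_apply, htop, neg_inj, Nat.cast_inj, hsup] at h
    exact h
  exact bts_aeval_twist_eq_pow_mul hhom (fun e : DegIdx (MatIdx m₀) m₀ => e.1 (topMatIdx m₀))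
    (fun u => (((u + j).descFactorial j : ℕ) : ℂ)) _ hwt hvan

end

end Summit.ValiantsHypothesis.ValiantsHypothesis.Theorems.TailFlip
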